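import Mathlib
import HarnessLib
import Summits.HubbardSuperconductivity.HubbardSuperconductivity.Theorems.KLProgrammeKLRegimeUVCovarianceSpaceTimeRowsAt
import Summits.HubbardSuperconductivity.HubbardSuperconductivity.Theorems.KLProgrammeKLRegimeTwoVolumeSectorPeriodisation

/-!
# Route `KLProgramme` — crux K3, child 4 VL (stmt-HubbardSuperconductivity-20440), located risk #8 «(VL)-DEAD-LEG»: the covariance data of
# the UV-dressed propagator `C^K_{>Λ}` in the SPACE-TIME currency — columns, `(1 + tnorm)`-weighted rows/columns and the far TAILS
# `≤ 8·(A₀ + 2X_R)/(R+1)`, at every cutoff `0 < Λ ≤ klE0`, uniform in `L` and `M`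

Cell gate-hubbard-kl, seat hubbard-kl-k3c4-p2 g10; companion of `…UVCovarianceSpaceTimeRowsAt` (generic `rowSumWt_/colSumWt_spaceTime_uvCov_le`,
`torusSum_uvCov_le`, `rowSum_spaceTime_uvCov_spaceTimeDist_le`).  With `S₁ := sectorSubMatrix V M β (trivialMultiplier V M)`, `ε := imagTimeWeight β M`,
`FrameOK R U N_sc μ K`, `R.WF`, `|U| ≤ 1`, `klBetaMin ≤ β`, `β³ ≤ M`, cutoff derivatives `≤ B` up to order `5`, `0 < Λ ≤ klE0`:

* `torusSum_uvCov_one_add_spaceWt_le` — the torus sum against `1 + |b̃|_{ℓ^∞}` (plain + space);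
* **`colSum_spaceTime_uvCov_spaceTimeDist_le`** — the column twin of `rowSum_spaceTime_uvCov_spaceTimeDist_le`;
* **`rowSum_spaceTime_uvCov_one_add_tnorm_le`** / **`colSum_…`** — `ε·Σ ‖(S₁ᵀ C S₁) Y Y′‖·(1 + tnorm(x⃗ − x⃗′)) ≤ 8·(A₀(Λ) + 2·X_R(Λ))`;
* **`farRowSum_spaceTime_uvCov_le`** / **`farColSum_spaceTime_uvCov_le`** — `ε·Σ_{tnorm(x⃗ − x⃗′) > R} ‖(S₁ᵀ C S₁) Y Y′‖ ≤ 8·(A₀(Λ) + 2·X_R(Λ))/(R+1)`: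
  the tails of the dressing beyond torus distance `R` vanish UNIFORMLY in `L`, `M` (the `τ`-type data of the two-volume transfer at `R ≍ L/(8n⋆)`);
* `uvSymbolCT_eq_sampled` (the UV symbol is the SAMPLED continuum symbol `(βV²)·Ψ¹_{e_K(p)}(ω_i)` at `p = 2πq⃗/V`, same function at every volume) and
  **`spaceTime_uvCov_periodise_leg`** — (P_T)/(P) for the dressing: at a common frame `K` and `Lf = b·L` the fine `S₁ᵀC^K_{>Λ}S₁` summed over the fibre of a
  coarse label is the coarse one (instance of k3c4-p1's `TwoPointAssembly.sectorPullback_periodise_leg` with the trivial family).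

Everything is proved; no definitions, no named facts.
-/

noncomputable section

namespace Summit.HubbardSuperconductivity.HubbardSuperconductivity.Theorems.UVCovarianceAt

set_option linter.dupNamespace false -- summit = problem name (single-conjunct summit), D-0017

open Real Finset Literature.MathematicalPhysics.QuantumLattice Literature.Probability.LatticeModels
open Literature.MathematicalPhysics.QuantumLattice.FermiRG
open Summit.HubbardSuperconductivity.HubbardSuperconductivity.Theorems.KLRegimeSplit
open Summit.HubbardSuperconductivity.HubbardSuperconductivity.Theorems.DispersionFlow
open Summit.HubbardSuperconductivity.HubbardSuperconductivity.Theorems.ScaleZeroDecay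
open Summit.HubbardSuperconductivity.HubbardSuperconductivity.Theorems.EngineV8
open Summit.HubbardSuperconductivity.HubbardSuperconductivity.Theorems.TwoVolumeDefect
open Summit.HubbardSuperconductivity.HubbardSuperconductivity.Theorems.TorusFourierL2

variable {L M : ℕ} [NeZero L] [NeZero M] {R : RenConsts} {U β μ Λ : ℝ} {Nsc : ℕ} {K : TrigPolyC4v} {B : ℝ}

/-- The torus sum against `1 + |b̃|_{ℓ^∞}` (plain + space): `≤ (2M/β)·(A₀(Λ) + 2·X_R(Λ))`. -/
theorem torusSum_uvCov_one_add_spaceWt_le (hK : FrameOK R U Nsc μ K) (hR : R.WF) (hU1 : |U| ≤ 1) (hβ : klBetaMin ≤ β) (hβM : β ^ 3 ≤ (M : ℝ))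
    (hB1 : 1 ≤ B) (hB : ∀ i ≤ 5, ∀ t, ‖iteratedDeriv i salmhoferCutoff t‖ ≤ B) (hΛ : 0 < Λ) (hΛe : Λ ≤ klE0) (σ : Fin 2) :
    ∑ a : TorusSite 1 (2 * M), ∑ bv : TorusSite 2 L,
        (1 + torusSiteDist bv 0) *
          ‖∑ q₀ : TorusSite 1 (2 * M), ∑ qv : TorusSite 2 L, torusChar q₀ a * torusChar qv bv *
            gridSymbol L M (2 * M) β (uvSymbolCT L M β μ K Λ) σ q₀ qv‖ ≤
      (((2 * M : ℕ)) : ℝ) / β *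
        (14 * Real.sqrt ((1 / 2 + 12 / Λ) *
            (2 / Λ + 128 * Real.pi ^ 4 * (4 * (1110 : ℝ) + 6 * (32 / 3) + 2) ^ 2 / Λ +
              2 * Real.pi ^ 5 * (4 * (1110 : ℝ) + 6 * (32 / 3) + 2) ^ 2 / Λ ^ 2 + 1 +
              Real.pi ^ 4 * ((7 : ℝ) ^ 2 * (4 * (1110 : ℝ) + 6 * (32 / 3) + 2) * (2 / Λ) + 7 * (2 * (32 / 3) + 1)) ^ 2 / Λ ^ 3)) +
          2 * (uvSpaceMomentConst Λ 1 (uvPieceSq Λ (uvBaseQ B Λ 4) (uvBaseQ' B Λ 4)) +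
            (1 / 4 * Real.sqrt (216 * (1 / Λ + 1 / 2)) *
                ∑ e : Fin 2 × Fin 2, (uvLinV Λ (1 + (e.1 : ℕ) + (e.2 : ℕ)) *
                    (B * ((1 + ((e.1 : ℕ) + (e.2 : ℕ)) + 2).factorial : ℝ) * (4 / Λ) ^ (1 + ((e.1 : ℕ) + (e.2 : ℕ)) + 1)) +
                  uvLinD Λ (1 + (e.1 : ℕ) + (e.2 : ℕ)) *
                    (B * ((1 + ((e.1 : ℕ) + (e.2 : ℕ)) + 3).factorial : ℝ) * (4 / Λ) ^ (1 + ((e.1 : ℕ) + (e.2 : ℕ)) + 2)))) *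
              (4608 * (1 + R.Gfr 0 + R.Gfr 1 + R.Gfr 2 + R.Gfr 3) ^ 4 * (((Nsc : ℝ) + 1) * U ^ 2 + 2 * |U|)))) := by
  set A0 : ℝ := 14 * Real.sqrt ((1 / 2 + 12 / Λ) *
        (2 / Λ + 128 * Real.pi ^ 4 * (4 * (1110 : ℝ) + 6 * (32 / 3) + 2) ^ 2 / Λ +
          2 * Real.pi ^ 5 * (4 * (1110 : ℝ) + 6 * (32 / 3) + 2) ^ 2 / Λ ^ 2 + 1 +
          Real.pi ^ 4 * ((7 : ℝ) ^ 2 * (4 * (1110 : ℝ) + 6 * (32 / 3) + 2) * (2 / Λ) + 7 * (2 * (32 / 3) + 1)) ^ 2 / Λ ^ 3)) with hA0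
  set XR : ℝ := uvSpaceMomentConst Λ 1 (uvPieceSq Λ (uvBaseQ B Λ 4) (uvBaseQ' B Λ 4)) +
            (1 / 4 * Real.sqrt (216 * (1 / Λ + 1 / 2)) *
                ∑ e : Fin 2 × Fin 2, (uvLinV Λ (1 + (e.1 : ℕ) + (e.2 : ℕ)) *
                    (B * ((1 + ((e.1 : ℕ) + (e.2 : ℕ)) + 2).factorial : ℝ) * (4 / Λ) ^ (1 + ((e.1 : ℕ) + (e.2 : ℕ)) + 1)) +
                  uvLinD Λ (1 + (e.1 : ℕ) + (e.2 : ℕ)) *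
                    (B * ((1 + ((e.1 : ℕ) + (e.2 : ℕ)) + 3).factorial : ℝ) * (4 / Λ) ^ (1 + ((e.1 : ℕ) + (e.2 : ℕ)) + 2)))) *
              (4608 * (1 + R.Gfr 0 + R.Gfr 1 + R.Gfr 2 + R.Gfr 3) ^ 4 * (((Nsc : ℝ) + 1) * U ^ 2 + 2 * |U|)) with hXR
  set S : TorusSite 1 (2 * M) → TorusSite 2 L → ℝ := fun a bv => ‖∑ q₀ : TorusSite 1 (2 * M), ∑ qv : TorusSite 2 L,
    torusChar q₀ a * torusChar qv bv * gridSymbol L M (2 * M) β (uvSymbolCT L M β μ K Λ) σ q₀ qv‖ with hS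
  have hplain : ∑ a : TorusSite 1 (2 * M), ∑ bv : TorusSite 2 L, S a bv ≤ ((((2 * M : ℕ)) : ℝ)) / β * A0 :=
    torusSum_uvCov_le (L := L) (N := 2 * M) hK hβ hβM hΛ hΛe le_rfl σ
  have hspace : ∑ a : TorusSite 1 (2 * M), ∑ bv : TorusSite 2 L, torusSiteDist bv 0 * S a bv ≤ ((((2 * M : ℕ)) : ℝ)) / β * (2 * XR) :=
    torusSum_uvCov_spaceWt_le (L := L) (N := 2 * M) hK hR hU1 hβ hβM le_rfl hB1 hB hΛ hΛe σ
  have hsplit : ∀ a bv, (1 + torusSiteDist bv 0) * S a bv = S a bv + torusSiteDist bv 0 * S a bv := fun a bv => by ring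
  show ∑ a : TorusSite 1 (2 * M), ∑ bv : TorusSite 2 L, (1 + torusSiteDist bv 0) * S a bv ≤ _
  simp_rw [hsplit, sum_add_distrib]
  rw [mul_add]
  exact add_le_add hplain hspace

/-- `ε·(8·((2M/β)·X)) = 8·X`. -/
theorem imagTimeWeight_mul_eight_mul (hβ : β ≠ 0) (X : ℝ) :
    imagTimeWeight β M * (8 * (((((2 * M : ℕ)) : ℝ)) / β * X)) = 8 * X := by
  have h1 := imagTimeWeight_mul_twoM_div (M := M) hβ
  calc imagTimeWeight β M * (8 * (((((2 * M : ℕ)) : ℝ)) / β * X)) = 8 * X * (imagTimeWeight β M * ((((2 * M : ℕ)) : ℝ) / β)) := by ring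
    _ = 8 * X := by rw [h1, mul_one]

/-- **`(1 + spaceTimeDist)`-weighted COLUMNS, space-time currency**:
`ε·Σ_{Y} ‖(S₁ᵀ C^K_{>Λ} S₁) Y Y′‖·(1 + spaceTimeDist (2M) ε 1 x x′) ≤ 8·(A₀(Λ) + uvTimeMomentConst Λ 7 32 + 2·X_R(Λ))`. -/
theorem colSum_spaceTime_uvCov_spaceTimeDist_le (hK : FrameOK R U Nsc μ K) (hR : R.WF) (hU1 : |U| ≤ 1) (hβ : klBetaMin ≤ β)
    (hβM : β ^ 3 ≤ (M : ℝ)) (hB1 : 1 ≤ B) (hB : ∀ i ≤ 5, ∀ t, ‖iteratedDeriv i salmhoferCutoff t‖ ≤ B) (hΛ : 0 < Λ) (hΛe : Λ ≤ klE0)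
    (Y' : SpaceTimeIdx L M × SectorLeg 1) :
    imagTimeWeight β M * ∑ Y : SpaceTimeIdx L M × SectorLeg 1,
        ‖((sectorSubMatrix L M β (trivialMultiplier L M)).transpose * hubbardCovAboveCT L M β μ 0 K Λ *
            sectorSubMatrix L M β (trivialMultiplier L M)) Y Y'‖ *
          (1 + Literature.MathematicalPhysics.QuantumLattice.spaceTimeDist (2 * M) (imagTimeWeight β M) 1 Y.1 Y'.1) ≤
      8 * (14 * Real.sqrt ((1 / 2 + 12 / Λ) *
            (2 / Λ + 128 * Real.pi ^ 4 * (4 * (1110 : ℝ) + 6 * (32 / 3) + 2) ^ 2 / Λ +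
              2 * Real.pi ^ 5 * (4 * (1110 : ℝ) + 6 * (32 / 3) + 2) ^ 2 / Λ ^ 2 + 1 +
              Real.pi ^ 4 * ((7 : ℝ) ^ 2 * (4 * (1110 : ℝ) + 6 * (32 / 3) + 2) * (2 / Λ) + 7 * (2 * (32 / 3) + 1)) ^ 2 / Λ ^ 3)) +
          uvTimeMomentConst Λ 7 32 +
          2 * (uvSpaceMomentConst Λ 1 (uvPieceSq Λ (uvBaseQ B Λ 4) (uvBaseQ' B Λ 4)) +
            (1 / 4 * Real.sqrt (216 * (1 / Λ + 1 / 2)) *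
                ∑ e : Fin 2 × Fin 2, (uvLinV Λ (1 + (e.1 : ℕ) + (e.2 : ℕ)) *
                    (B * ((1 + ((e.1 : ℕ) + (e.2 : ℕ)) + 2).factorial : ℝ) * (4 / Λ) ^ (1 + ((e.1 : ℕ) + (e.2 : ℕ)) + 1)) +
                  uvLinD Λ (1 + (e.1 : ℕ) + (e.2 : ℕ)) *
                    (B * ((1 + ((e.1 : ℕ) + (e.2 : ℕ)) + 3).factorial : ℝ) * (4 / Λ) ^ (1 + ((e.1 : ℕ) + (e.2 : ℕ)) + 2)))) *
              (4608 * (1 + R.Gfr 0 + R.Gfr 1 + R.Gfr 2 + R.Gfr 3) ^ 4 * (((Nsc : ℝ) + 1) * U ^ 2 + 2 * |U|)))) := by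
  have hβ0 : 0 < β := beta_pos_of_klBetaMin_le hβ
  set Tot : ℝ := 14 * Real.sqrt ((1 / 2 + 12 / Λ) *
            (2 / Λ + 128 * Real.pi ^ 4 * (4 * (1110 : ℝ) + 6 * (32 / 3) + 2) ^ 2 / Λ +
              2 * Real.pi ^ 5 * (4 * (1110 : ℝ) + 6 * (32 / 3) + 2) ^ 2 / Λ ^ 2 + 1 +
              Real.pi ^ 4 * ((7 : ℝ) ^ 2 * (4 * (1110 : ℝ) + 6 * (32 / 3) + 2) * (2 / Λ) + 7 * (2 * (32 / 3) + 1)) ^ 2 / Λ ^ 3)) +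
          uvTimeMomentConst Λ 7 32 +
          2 * (uvSpaceMomentConst Λ 1 (uvPieceSq Λ (uvBaseQ B Λ 4) (uvBaseQ' B Λ 4)) +
            (1 / 4 * Real.sqrt (216 * (1 / Λ + 1 / 2)) *
                ∑ e : Fin 2 × Fin 2, (uvLinV Λ (1 + (e.1 : ℕ) + (e.2 : ℕ)) *
                    (B * ((1 + ((e.1 : ℕ) + (e.2 : ℕ)) + 2).factorial : ℝ) * (4 / Λ) ^ (1 + ((e.1 : ℕ) + (e.2 : ℕ)) + 1)) +
                  uvLinD Λ (1 + (e.1 : ℕ) + (e.2 : ℕ)) *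
                    (B * ((1 + ((e.1 : ℕ) + (e.2 : ℕ)) + 3).factorial : ℝ) * (4 / Λ) ^ (1 + ((e.1 : ℕ) + (e.2 : ℕ)) + 2)))) *
              (4608 * (1 + R.Gfr 0 + R.Gfr 1 + R.Gfr 2 + R.Gfr 3) ^ 4 * (((Nsc : ℝ) + 1) * U ^ 2 + 2 * |U|))) with hTot
  set w : TorusSite 1 (2 * M) × TorusSite 2 L → ℝ := fun z => 1 + (imagTimeWeight β M * cyclicDist (2 * M) (z.1 0) 0 + torusSiteDist z.2 0)
    with hw
  have hw0 : ∀ z, 0 ≤ w z := fun z => by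
    have h1 : (0 : ℝ) ≤ cyclicDist (2 * M) (z.1 0) 0 := by rw [cyclicDist_zero_eq_abs_valMinAbs]; exact abs_nonneg _
    have h2 : (0 : ℝ) ≤ torusSiteDist z.2 0 := isLabelDist_torusSiteDist.nonneg _ _
    have h3 := imagTimeWeight_nonneg hβ0.le M
    simp only [hw]
    positivity
  have hweven : ∀ a b, w (-a, -b) = w (a, b) := fun a b => by
    simp only [hw, Pi.neg_apply, cyclicDist_neg_zero, torusSiteDist_neg_zero]
  have hA : ∀ σ : Fin 2, ∑ a : TorusSite 1 (2 * M), ∑ bv : TorusSite 2 L, w (a, bv) *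
      ‖∑ q₀ : TorusSite 1 (2 * M), ∑ qv : TorusSite 2 L, torusChar q₀ a * torusChar qv bv *
        gridSymbol L M (2 * M) β (uvSymbolCT L M β μ K Λ) σ q₀ qv‖ ≤ ((((2 * M : ℕ)) : ℝ)) / β * Tot := fun σ =>
    torusSum_uvCov_spaceTimeWt_le (L := L) hK hR hU1 hβ hβM hB1 hB hΛ hΛe σ
  have h := colSumWt_spaceTime_uvCov_le (L := L) (M := M) (μ := μ) (K := K) (Λ := Λ) hβ0 w hw0 hweven hA Y'
  have hwt : ∀ Y : SpaceTimeIdx L M × SectorLeg 1,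
      w ((fun _ : Fin 1 => ((Y.1.1 : ℕ) : ZMod (2 * M)) - ((Y'.1.1 : ℕ) : ZMod (2 * M))), Y.1.2 - Y'.1.2) =
        1 + Literature.MathematicalPhysics.QuantumLattice.spaceTimeDist (2 * M) (imagTimeWeight β M) 1 Y.1 Y'.1 := by
    intro Y
    have hc : ∀ a b : ZMod (2 * M), cyclicDist (2 * M) a b = cyclicDist (2 * M) (a - b) 0 := fun a b => by simp [cyclicDist]
    simp only [hw, Literature.MathematicalPhysics.QuantumLattice.spaceTimeDist, finCyclicDist, one_mul]
    rw [← hc, ← torusSiteDist_eq_sub_zero]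
  simp_rw [hwt] at h
  calc _ ≤ imagTimeWeight β M * (8 * (((((2 * M : ℕ)) : ℝ)) / β * Tot)) := mul_le_mul_of_nonneg_left h (imagTimeWeight_nonneg hβ0.le M)
    _ = 8 * Tot := imagTimeWeight_mul_eight_mul hβ0.ne' Tot

/-- **`(1 + tnorm)`-weighted ROWS, space-time currency**: `ε·Σ_{Y′} ‖(S₁ᵀ C S₁) Y Y′‖·(1 + tnorm(x⃗ − x⃗′)) ≤ 8·(A₀(Λ) + 2·X_R(Λ))`. -/
theorem rowSum_spaceTime_uvCov_one_add_tnorm_le (hK : FrameOK R U Nsc μ K) (hR : R.WF) (hU1 : |U| ≤ 1) (hβ : klBetaMin ≤ β)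
    (hβM : β ^ 3 ≤ (M : ℝ)) (hB1 : 1 ≤ B) (hB : ∀ i ≤ 5, ∀ t, ‖iteratedDeriv i salmhoferCutoff t‖ ≤ B) (hΛ : 0 < Λ) (hΛe : Λ ≤ klE0)
    (Y : SpaceTimeIdx L M × SectorLeg 1) :
    imagTimeWeight β M * ∑ Y' : SpaceTimeIdx L M × SectorLeg 1,
        ‖((sectorSubMatrix L M β (trivialMultiplier L M)).transpose * hubbardCovAboveCT L M β μ 0 K Λ *
            sectorSubMatrix L M β (trivialMultiplier L M)) Y Y'‖ * (1 + (Torus.tnorm (Y.1.2 - Y'.1.2) : ℝ)) ≤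
      8 * (14 * Real.sqrt ((1 / 2 + 12 / Λ) *
            (2 / Λ + 128 * Real.pi ^ 4 * (4 * (1110 : ℝ) + 6 * (32 / 3) + 2) ^ 2 / Λ +
              2 * Real.pi ^ 5 * (4 * (1110 : ℝ) + 6 * (32 / 3) + 2) ^ 2 / Λ ^ 2 + 1 +
              Real.pi ^ 4 * ((7 : ℝ) ^ 2 * (4 * (1110 : ℝ) + 6 * (32 / 3) + 2) * (2 / Λ) + 7 * (2 * (32 / 3) + 1)) ^ 2 / Λ ^ 3)) +
          2 * (uvSpaceMomentConst Λ 1 (uvPieceSq Λ (uvBaseQ B Λ 4) (uvBaseQ' B Λ 4)) +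
            (1 / 4 * Real.sqrt (216 * (1 / Λ + 1 / 2)) *
                ∑ e : Fin 2 × Fin 2, (uvLinV Λ (1 + (e.1 : ℕ) + (e.2 : ℕ)) *
                    (B * ((1 + ((e.1 : ℕ) + (e.2 : ℕ)) + 2).factorial : ℝ) * (4 / Λ) ^ (1 + ((e.1 : ℕ) + (e.2 : ℕ)) + 1)) +
                  uvLinD Λ (1 + (e.1 : ℕ) + (e.2 : ℕ)) *
                    (B * ((1 + ((e.1 : ℕ) + (e.2 : ℕ)) + 3).factorial : ℝ) * (4 / Λ) ^ (1 + ((e.1 : ℕ) + (e.2 : ℕ)) + 2)))) *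
              (4608 * (1 + R.Gfr 0 + R.Gfr 1 + R.Gfr 2 + R.Gfr 3) ^ 4 * (((Nsc : ℝ) + 1) * U ^ 2 + 2 * |U|)))) := by
  have hβ0 : 0 < β := beta_pos_of_klBetaMin_le hβ
  set Tot : ℝ := 14 * Real.sqrt ((1 / 2 + 12 / Λ) *
            (2 / Λ + 128 * Real.pi ^ 4 * (4 * (1110 : ℝ) + 6 * (32 / 3) + 2) ^ 2 / Λ +
              2 * Real.pi ^ 5 * (4 * (1110 : ℝ) + 6 * (32 / 3) + 2) ^ 2 / Λ ^ 2 + 1 +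
              Real.pi ^ 4 * ((7 : ℝ) ^ 2 * (4 * (1110 : ℝ) + 6 * (32 / 3) + 2) * (2 / Λ) + 7 * (2 * (32 / 3) + 1)) ^ 2 / Λ ^ 3)) +
          2 * (uvSpaceMomentConst Λ 1 (uvPieceSq Λ (uvBaseQ B Λ 4) (uvBaseQ' B Λ 4)) +
            (1 / 4 * Real.sqrt (216 * (1 / Λ + 1 / 2)) *
                ∑ e : Fin 2 × Fin 2, (uvLinV Λ (1 + (e.1 : ℕ) + (e.2 : ℕ)) *
                    (B * ((1 + ((e.1 : ℕ) + (e.2 : ℕ)) + 2).factorial : ℝ) * (4 / Λ) ^ (1 + ((e.1 : ℕ) + (e.2 : ℕ)) + 1)) +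
                  uvLinD Λ (1 + (e.1 : ℕ) + (e.2 : ℕ)) *
                    (B * ((1 + ((e.1 : ℕ) + (e.2 : ℕ)) + 3).factorial : ℝ) * (4 / Λ) ^ (1 + ((e.1 : ℕ) + (e.2 : ℕ)) + 2)))) *
              (4608 * (1 + R.Gfr 0 + R.Gfr 1 + R.Gfr 2 + R.Gfr 3) ^ 4 * (((Nsc : ℝ) + 1) * U ^ 2 + 2 * |U|))) with hTot
  set w : TorusSite 1 (2 * M) × TorusSite 2 L → ℝ := fun z => 1 + torusSiteDist z.2 0 with hw
  have hw0 : ∀ z, 0 ≤ w z := fun z => by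
    have h2 : (0 : ℝ) ≤ torusSiteDist z.2 0 := isLabelDist_torusSiteDist.nonneg _ _
    simp only [hw]; positivity
  have hweven : ∀ a b, w (-a, -b) = w (a, b) := fun a b => by simp only [hw, torusSiteDist_neg_zero]
  have hA : ∀ σ : Fin 2, ∑ a : TorusSite 1 (2 * M), ∑ bv : TorusSite 2 L, w (a, bv) *
      ‖∑ q₀ : TorusSite 1 (2 * M), ∑ qv : TorusSite 2 L, torusChar q₀ a * torusChar qv bv *
        gridSymbol L M (2 * M) β (uvSymbolCT L M β μ K Λ) σ q₀ qv‖ ≤ ((((2 * M : ℕ)) : ℝ)) / β * Tot := fun σ =>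
    torusSum_uvCov_one_add_spaceWt_le (L := L) hK hR hU1 hβ hβM hB1 hB hΛ hΛe σ
  have h := rowSumWt_spaceTime_uvCov_le (L := L) (M := M) (μ := μ) (K := K) (Λ := Λ) hβ0 w hw0 hweven hA Y
  have hwt : ∀ Y' : SpaceTimeIdx L M × SectorLeg 1,
      w ((fun _ : Fin 1 => ((Y.1.1 : ℕ) : ZMod (2 * M)) - ((Y'.1.1 : ℕ) : ZMod (2 * M))), Y.1.2 - Y'.1.2) =
        1 + (Torus.tnorm (Y.1.2 - Y'.1.2) : ℝ) := by
    intro Y'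
    simp only [hw]
    rw [tnorm_sub_eq_torusSiteDist, torusSiteDist_eq_sub_zero Y.1.2]
  simp_rw [hwt] at h
  calc _ ≤ imagTimeWeight β M * (8 * (((((2 * M : ℕ)) : ℝ)) / β * Tot)) := mul_le_mul_of_nonneg_left h (imagTimeWeight_nonneg hβ0.le M)
    _ = 8 * Tot := imagTimeWeight_mul_eight_mul hβ0.ne' Tot

/-- **`(1 + tnorm)`-weighted COLUMNS, space-time currency.** -/
theorem colSum_spaceTime_uvCov_one_add_tnorm_le (hK : FrameOK R U Nsc μ K) (hR : R.WF) (hU1 : |U| ≤ 1) (hβ : klBetaMin ≤ β)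
    (hβM : β ^ 3 ≤ (M : ℝ)) (hB1 : 1 ≤ B) (hB : ∀ i ≤ 5, ∀ t, ‖iteratedDeriv i salmhoferCutoff t‖ ≤ B) (hΛ : 0 < Λ) (hΛe : Λ ≤ klE0)
    (Y' : SpaceTimeIdx L M × SectorLeg 1) :
    imagTimeWeight β M * ∑ Y : SpaceTimeIdx L M × SectorLeg 1,
        ‖((sectorSubMatrix L M β (trivialMultiplier L M)).transpose * hubbardCovAboveCT L M β μ 0 K Λ *
            sectorSubMatrix L M β (trivialMultiplier L M)) Y Y'‖ * (1 + (Torus.tnorm (Y.1.2 - Y'.1.2) : ℝ)) ≤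
      8 * (14 * Real.sqrt ((1 / 2 + 12 / Λ) *
            (2 / Λ + 128 * Real.pi ^ 4 * (4 * (1110 : ℝ) + 6 * (32 / 3) + 2) ^ 2 / Λ +
              2 * Real.pi ^ 5 * (4 * (1110 : ℝ) + 6 * (32 / 3) + 2) ^ 2 / Λ ^ 2 + 1 +
              Real.pi ^ 4 * ((7 : ℝ) ^ 2 * (4 * (1110 : ℝ) + 6 * (32 / 3) + 2) * (2 / Λ) + 7 * (2 * (32 / 3) + 1)) ^ 2 / Λ ^ 3)) +
          2 * (uvSpaceMomentConst Λ 1 (uvPieceSq Λ (uvBaseQ B Λ 4) (uvBaseQ' B Λ 4)) +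
            (1 / 4 * Real.sqrt (216 * (1 / Λ + 1 / 2)) *
                ∑ e : Fin 2 × Fin 2, (uvLinV Λ (1 + (e.1 : ℕ) + (e.2 : ℕ)) *
                    (B * ((1 + ((e.1 : ℕ) + (e.2 : ℕ)) + 2).factorial : ℝ) * (4 / Λ) ^ (1 + ((e.1 : ℕ) + (e.2 : ℕ)) + 1)) +
                  uvLinD Λ (1 + (e.1 : ℕ) + (e.2 : ℕ)) *
                    (B * ((1 + ((e.1 : ℕ) + (e.2 : ℕ)) + 3).factorial : ℝ) * (4 / Λ) ^ (1 + ((e.1 : ℕ) + (e.2 : ℕ)) + 2)))) *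
              (4608 * (1 + R.Gfr 0 + R.Gfr 1 + R.Gfr 2 + R.Gfr 3) ^ 4 * (((Nsc : ℝ) + 1) * U ^ 2 + 2 * |U|)))) := by
  have hβ0 : 0 < β := beta_pos_of_klBetaMin_le hβ
  set Tot : ℝ := 14 * Real.sqrt ((1 / 2 + 12 / Λ) *
            (2 / Λ + 128 * Real.pi ^ 4 * (4 * (1110 : ℝ) + 6 * (32 / 3) + 2) ^ 2 / Λ +
              2 * Real.pi ^ 5 * (4 * (1110 : ℝ) + 6 * (32 / 3) + 2) ^ 2 / Λ ^ 2 + 1 +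
              Real.pi ^ 4 * ((7 : ℝ) ^ 2 * (4 * (1110 : ℝ) + 6 * (32 / 3) + 2) * (2 / Λ) + 7 * (2 * (32 / 3) + 1)) ^ 2 / Λ ^ 3)) +
          2 * (uvSpaceMomentConst Λ 1 (uvPieceSq Λ (uvBaseQ B Λ 4) (uvBaseQ' B Λ 4)) +
            (1 / 4 * Real.sqrt (216 * (1 / Λ + 1 / 2)) *
                ∑ e : Fin 2 × Fin 2, (uvLinV Λ (1 + (e.1 : ℕ) + (e.2 : ℕ)) *
                    (B * ((1 + ((e.1 : ℕ) + (e.2 : ℕ)) + 2).factorial : ℝ) * (4 / Λ) ^ (1 + ((e.1 : ℕ) + (e.2 : ℕ)) + 1)) +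
                  uvLinD Λ (1 + (e.1 : ℕ) + (e.2 : ℕ)) *
                    (B * ((1 + ((e.1 : ℕ) + (e.2 : ℕ)) + 3).factorial : ℝ) * (4 / Λ) ^ (1 + ((e.1 : ℕ) + (e.2 : ℕ)) + 2)))) *
              (4608 * (1 + R.Gfr 0 + R.Gfr 1 + R.Gfr 2 + R.Gfr 3) ^ 4 * (((Nsc : ℝ) + 1) * U ^ 2 + 2 * |U|))) with hTot
  set w : TorusSite 1 (2 * M) × TorusSite 2 L → ℝ := fun z => 1 + torusSiteDist z.2 0 with hw
  have hw0 : ∀ z, 0 ≤ w z := fun z => by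
    have h2 : (0 : ℝ) ≤ torusSiteDist z.2 0 := isLabelDist_torusSiteDist.nonneg _ _
    simp only [hw]; positivity
  have hweven : ∀ a b, w (-a, -b) = w (a, b) := fun a b => by simp only [hw, torusSiteDist_neg_zero]
  have hA : ∀ σ : Fin 2, ∑ a : TorusSite 1 (2 * M), ∑ bv : TorusSite 2 L, w (a, bv) *
      ‖∑ q₀ : TorusSite 1 (2 * M), ∑ qv : TorusSite 2 L, torusChar q₀ a * torusChar qv bv *
        gridSymbol L M (2 * M) β (uvSymbolCT L M β μ K Λ) σ q₀ qv‖ ≤ ((((2 * M : ℕ)) : ℝ)) / β * Tot := fun σ =>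
    torusSum_uvCov_one_add_spaceWt_le (L := L) hK hR hU1 hβ hβM hB1 hB hΛ hΛe σ
  have h := colSumWt_spaceTime_uvCov_le (L := L) (M := M) (μ := μ) (K := K) (Λ := Λ) hβ0 w hw0 hweven hA Y'
  have hwt : ∀ Y : SpaceTimeIdx L M × SectorLeg 1,
      w ((fun _ : Fin 1 => ((Y.1.1 : ℕ) : ZMod (2 * M)) - ((Y'.1.1 : ℕ) : ZMod (2 * M))), Y.1.2 - Y'.1.2) =
        1 + (Torus.tnorm (Y.1.2 - Y'.1.2) : ℝ) := by
    intro Y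
    simp only [hw]
    rw [tnorm_sub_eq_torusSiteDist, torusSiteDist_eq_sub_zero Y.1.2]
  simp_rw [hwt] at h
  calc _ ≤ imagTimeWeight β M * (8 * (((((2 * M : ℕ)) : ℝ)) / β * Tot)) := mul_le_mul_of_nonneg_left h (imagTimeWeight_nonneg hβ0.le M)
    _ = 8 * Tot := imagTimeWeight_mul_eight_mul hβ0.ne' Tot

/-- **The far ROW tails, space-time currency**: `ε·Σ_{Y′ : R < tnorm(x⃗ − x⃗′)} ‖(S₁ᵀ C^K_{>Λ} S₁) Y Y′‖ ≤ 8·(A₀(Λ) + 2·X_R(Λ))/(R+1)`. -/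
theorem farRowSum_spaceTime_uvCov_le (hK : FrameOK R U Nsc μ K) (hR : R.WF) (hU1 : |U| ≤ 1) (hβ : klBetaMin ≤ β)
    (hβM : β ^ 3 ≤ (M : ℝ)) (hB1 : 1 ≤ B) (hB : ∀ i ≤ 5, ∀ t, ‖iteratedDeriv i salmhoferCutoff t‖ ≤ B) (hΛ : 0 < Λ) (hΛe : Λ ≤ klE0)
    (Rfar : ℕ) (Y : SpaceTimeIdx L M × SectorLeg 1) :
    imagTimeWeight β M * ∑ Y' ∈ univ.filter (fun Y' : SpaceTimeIdx L M × SectorLeg 1 => Rfar < Torus.tnorm (Y.1.2 - Y'.1.2)),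
        ‖((sectorSubMatrix L M β (trivialMultiplier L M)).transpose * hubbardCovAboveCT L M β μ 0 K Λ *
            sectorSubMatrix L M β (trivialMultiplier L M)) Y Y'‖ ≤
      8 * (14 * Real.sqrt ((1 / 2 + 12 / Λ) *
            (2 / Λ + 128 * Real.pi ^ 4 * (4 * (1110 : ℝ) + 6 * (32 / 3) + 2) ^ 2 / Λ +
              2 * Real.pi ^ 5 * (4 * (1110 : ℝ) + 6 * (32 / 3) + 2) ^ 2 / Λ ^ 2 + 1 +
              Real.pi ^ 4 * ((7 : ℝ) ^ 2 * (4 * (1110 : ℝ) + 6 * (32 / 3) + 2) * (2 / Λ) + 7 * (2 * (32 / 3) + 1)) ^ 2 / Λ ^ 3)) +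
          2 * (uvSpaceMomentConst Λ 1 (uvPieceSq Λ (uvBaseQ B Λ 4) (uvBaseQ' B Λ 4)) +
            (1 / 4 * Real.sqrt (216 * (1 / Λ + 1 / 2)) *
                ∑ e : Fin 2 × Fin 2, (uvLinV Λ (1 + (e.1 : ℕ) + (e.2 : ℕ)) *
                    (B * ((1 + ((e.1 : ℕ) + (e.2 : ℕ)) + 2).factorial : ℝ) * (4 / Λ) ^ (1 + ((e.1 : ℕ) + (e.2 : ℕ)) + 1)) +
                  uvLinD Λ (1 + (e.1 : ℕ) + (e.2 : ℕ)) *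
                    (B * ((1 + ((e.1 : ℕ) + (e.2 : ℕ)) + 3).factorial : ℝ) * (4 / Λ) ^ (1 + ((e.1 : ℕ) + (e.2 : ℕ)) + 2)))) *
              (4608 * (1 + R.Gfr 0 + R.Gfr 1 + R.Gfr 2 + R.Gfr 3) ^ 4 * (((Nsc : ℝ) + 1) * U ^ 2 + 2 * |U|)))) / ((Rfar : ℝ) + 1) := by
  have hβ0 : 0 < β := beta_pos_of_klBetaMin_le hβ
  have hrow := rowSum_spaceTime_uvCov_one_add_tnorm_le (L := L) hK hR hU1 hβ hβM hB1 hB hΛ hΛe Y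
  set G := (sectorSubMatrix L M β (trivialMultiplier L M)).transpose * hubbardCovAboveCT L M β μ 0 K Λ *
    sectorSubMatrix L M β (trivialMultiplier L M) with hG
  have h := sum_filter_le_div_of_weight univ (fun Y' => ‖G Y Y'‖) (fun Y' : SpaceTimeIdx L M × SectorLeg 1 => Torus.tnorm (Y.1.2 - Y'.1.2))
    (fun _ _ => norm_nonneg _) Rfar
  have hle : ∑ Y' : SpaceTimeIdx L M × SectorLeg 1, (Torus.tnorm (Y.1.2 - Y'.1.2) : ℝ) * ‖G Y Y'‖ ≤
      ∑ Y' : SpaceTimeIdx L M × SectorLeg 1, ‖G Y Y'‖ * (1 + (Torus.tnorm (Y.1.2 - Y'.1.2) : ℝ)) :=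
    sum_le_sum fun Y' _ => by
      nlinarith [norm_nonneg (G Y Y'), (Nat.cast_nonneg (Torus.tnorm (Y.1.2 - Y'.1.2)) : (0 : ℝ) ≤ _)]
  have hε := imagTimeWeight_nonneg hβ0.le M
  rw [le_div_iff₀ (by positivity : (0 : ℝ) < (Rfar : ℝ) + 1)]
  calc imagTimeWeight β M * (∑ Y' ∈ univ.filter (fun Y' : SpaceTimeIdx L M × SectorLeg 1 => Rfar < Torus.tnorm (Y.1.2 - Y'.1.2)), ‖G Y Y'‖) *
        ((Rfar : ℝ) + 1)
      ≤ imagTimeWeight β M * ((((Rfar : ℝ) + 1)⁻¹ * ∑ Y' : SpaceTimeIdx L M × SectorLeg 1, (Torus.tnorm (Y.1.2 - Y'.1.2) : ℝ) * ‖G Y Y'‖)) *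
          ((Rfar : ℝ) + 1) := by gcongr
    _ = imagTimeWeight β M * ∑ Y' : SpaceTimeIdx L M × SectorLeg 1, (Torus.tnorm (Y.1.2 - Y'.1.2) : ℝ) * ‖G Y Y'‖ := by
        field_simp
    _ ≤ imagTimeWeight β M * ∑ Y' : SpaceTimeIdx L M × SectorLeg 1, ‖G Y Y'‖ * (1 + (Torus.tnorm (Y.1.2 - Y'.1.2) : ℝ)) :=
        mul_le_mul_of_nonneg_left hle hε
    _ ≤ _ := hrow

/-- **The far COLUMN tails, space-time currency**: `ε·Σ_{Y : R < tnorm(x⃗ − x⃗′)} ‖(S₁ᵀ C^K_{>Λ} S₁) Y Y′‖ ≤ 8·(A₀(Λ) + 2·X_R(Λ))/(R+1)`. -/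
theorem farColSum_spaceTime_uvCov_le (hK : FrameOK R U Nsc μ K) (hR : R.WF) (hU1 : |U| ≤ 1) (hβ : klBetaMin ≤ β)
    (hβM : β ^ 3 ≤ (M : ℝ)) (hB1 : 1 ≤ B) (hB : ∀ i ≤ 5, ∀ t, ‖iteratedDeriv i salmhoferCutoff t‖ ≤ B) (hΛ : 0 < Λ) (hΛe : Λ ≤ klE0)
    (Rfar : ℕ) (Y' : SpaceTimeIdx L M × SectorLeg 1) :
    imagTimeWeight β M * ∑ Y ∈ univ.filter (fun Y : SpaceTimeIdx L M × SectorLeg 1 => Rfar < Torus.tnorm (Y.1.2 - Y'.1.2)),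
        ‖((sectorSubMatrix L M β (trivialMultiplier L M)).transpose * hubbardCovAboveCT L M β μ 0 K Λ *
            sectorSubMatrix L M β (trivialMultiplier L M)) Y Y'‖ ≤
      8 * (14 * Real.sqrt ((1 / 2 + 12 / Λ) *
            (2 / Λ + 128 * Real.pi ^ 4 * (4 * (1110 : ℝ) + 6 * (32 / 3) + 2) ^ 2 / Λ +
              2 * Real.pi ^ 5 * (4 * (1110 : ℝ) + 6 * (32 / 3) + 2) ^ 2 / Λ ^ 2 + 1 +
              Real.pi ^ 4 * ((7 : ℝ) ^ 2 * (4 * (1110 : ℝ) + 6 * (32 / 3) + 2) * (2 / Λ) + 7 * (2 * (32 / 3) + 1)) ^ 2 / Λ ^ 3)) +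
          2 * (uvSpaceMomentConst Λ 1 (uvPieceSq Λ (uvBaseQ B Λ 4) (uvBaseQ' B Λ 4)) +
            (1 / 4 * Real.sqrt (216 * (1 / Λ + 1 / 2)) *
                ∑ e : Fin 2 × Fin 2, (uvLinV Λ (1 + (e.1 : ℕ) + (e.2 : ℕ)) *
                    (B * ((1 + ((e.1 : ℕ) + (e.2 : ℕ)) + 2).factorial : ℝ) * (4 / Λ) ^ (1 + ((e.1 : ℕ) + (e.2 : ℕ)) + 1)) +
                  uvLinD Λ (1 + (e.1 : ℕ) + (e.2 : ℕ)) *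
                    (B * ((1 + ((e.1 : ℕ) + (e.2 : ℕ)) + 3).factorial : ℝ) * (4 / Λ) ^ (1 + ((e.1 : ℕ) + (e.2 : ℕ)) + 2)))) *
              (4608 * (1 + R.Gfr 0 + R.Gfr 1 + R.Gfr 2 + R.Gfr 3) ^ 4 * (((Nsc : ℝ) + 1) * U ^ 2 + 2 * |U|)))) / ((Rfar : ℝ) + 1) := by
  have hβ0 : 0 < β := beta_pos_of_klBetaMin_le hβ
  have hcol := colSum_spaceTime_uvCov_one_add_tnorm_le (L := L) hK hR hU1 hβ hβM hB1 hB hΛ hΛe Y'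
  set G := (sectorSubMatrix L M β (trivialMultiplier L M)).transpose * hubbardCovAboveCT L M β μ 0 K Λ *
    sectorSubMatrix L M β (trivialMultiplier L M) with hG
  have hle : ∑ Y : SpaceTimeIdx L M × SectorLeg 1, (Torus.tnorm (Y.1.2 - Y'.1.2) : ℝ) * ‖G Y Y'‖ ≤
      ∑ Y : SpaceTimeIdx L M × SectorLeg 1, ‖G Y Y'‖ * (1 + (Torus.tnorm (Y.1.2 - Y'.1.2) : ℝ)) :=
    sum_le_sum fun Y _ => by
      nlinarith [norm_nonneg (G Y Y'), (Nat.cast_nonneg (Torus.tnorm (Y.1.2 - Y'.1.2)) : (0 : ℝ) ≤ _)]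
  have hε := imagTimeWeight_nonneg hβ0.le M
  have h := sum_filter_le_div_of_weight univ (fun Y => ‖G Y Y'‖) (fun Y : SpaceTimeIdx L M × SectorLeg 1 => Torus.tnorm (Y.1.2 - Y'.1.2))
    (fun _ _ => norm_nonneg _) Rfar
  rw [le_div_iff₀ (by positivity : (0 : ℝ) < (Rfar : ℝ) + 1)]
  calc imagTimeWeight β M * (∑ Y ∈ univ.filter (fun Y : SpaceTimeIdx L M × SectorLeg 1 => Rfar < Torus.tnorm (Y.1.2 - Y'.1.2)), ‖G Y Y'‖) *
        ((Rfar : ℝ) + 1)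
      ≤ imagTimeWeight β M * ((((Rfar : ℝ) + 1)⁻¹ * ∑ Y : SpaceTimeIdx L M × SectorLeg 1, (Torus.tnorm (Y.1.2 - Y'.1.2) : ℝ) * ‖G Y Y'‖)) *
          ((Rfar : ℝ) + 1) := by gcongr
    _ = imagTimeWeight β M * ∑ Y : SpaceTimeIdx L M × SectorLeg 1, (Torus.tnorm (Y.1.2 - Y'.1.2) : ℝ) * ‖G Y Y'‖ := by
        field_simp
    _ ≤ imagTimeWeight β M * ∑ Y : SpaceTimeIdx L M × SectorLeg 1, ‖G Y Y'‖ * (1 + (Torus.tnorm (Y.1.2 - Y'.1.2) : ℝ)) :=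
        mul_le_mul_of_nonneg_left hle hε
    _ ≤ _ := hcol

/-! ## (P) The dressing is a sampled symbol: block periodisation between nested volumes -/

omit [NeZero M] in
/-- **The UV symbol is SAMPLED**: `uvSymbolCT V M β μ K Λ ((i,q⃗),σ) = (βV²)·Ψ¹(ω_i, e_K(2πq⃗/V))` with the volume-free continuum function
`Ψ¹(ω, e) = uvSymbolFn 1 Λ e ω` and the frame band `e_K = ctBandFn μ K` (`0 < β`). -/
theorem uvSymbolCT_eq_sampled (hβ : 0 < β) (μ : ℝ) (K : TrigPolyC4v) (Λ : ℝ) (k : FreqMomentum L M) (σ : Fin 2) :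
    uvSymbolCT L M β μ K Λ (k, σ) =
      ((β * (L : ℝ) ^ 2 : ℝ) : ℂ) * uvSymbolFn 1 Λ (ctBandFn μ K (latticeMomentum L k.2)) (matsubaraFreq β M k.1) := by
  obtain ⟨i, q⟩ := k
  rw [uvSymbolCT_eq_uvSymbolFn hβ μ K Λ i q σ, nambuXiCT_eq_ctBandFn]
  simp only [uvSymbolFn, resolventFn]
  push_cast
  ring

/-- **(P) FOR THE DRESSING `S₁ᵀ C^K_{>Λ} S₁` BETWEEN NESTED VOLUMES** (`Lf = b·L`, common frame `K`, `0 < β`): for any block structure `e` of the fine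
space-time labels whose projection is the reduction of the site, the fine covariance summed over the fibre of a coarse label equals the coarse covariance —
the `hP` hypothesis of `TwoVolumeDefect.sum_norm_kernel_map_glue_sub_glue_map_le` / `…_of_defect` for a dressing substitution. -/
theorem spaceTime_uvCov_periodise_leg {Lf b : ℕ} [NeZero Lf] (hLf : Lf = b * L) (hβ : 0 < β) (μ : ℝ) (K : TrigPolyC4v) (Λ : ℝ)
    {ι : Type*} (e : (SpaceTimeIdx Lf M × SectorLeg 1) ≃ ι × (SpaceTimeIdx L M × SectorLeg 1))
    (he2 : ∀ X', (e X').2 = ((X'.1.1, fun i => (((X'.1.2 i).val : ℕ) : ZMod L)), X'.2))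
    (X' : SpaceTimeIdx Lf M × SectorLeg 1) (Y : SpaceTimeIdx L M × SectorLeg 1) :
    ∑ Y'' ∈ univ.filter (fun Y'' : SpaceTimeIdx Lf M × SectorLeg 1 => (e Y'').2 = Y),
        ((sectorSubMatrix Lf M β (trivialMultiplier Lf M)).transpose * hubbardCovAboveCT Lf M β μ 0 K Λ *
          sectorSubMatrix Lf M β (trivialMultiplier Lf M)) X' Y'' =
      ((sectorSubMatrix L M β (trivialMultiplier L M)).transpose * hubbardCovAboveCT L M β μ 0 K Λ *
          sectorSubMatrix L M β (trivialMultiplier L M)) (e X').2 Y := by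
  rw [hubbardCovAboveCT_zero_seed_eq_normalCovariance_uvSymbolCT, hubbardCovAboveCT_zero_seed_eq_normalCovariance_uvSymbolCT]
  exact TwoPointAssembly.sectorPullback_periodise_leg hLf hβ.ne' (fun _ _ _ => (1 : ℂ))
    (fun i _ p => uvSymbolFn 1 Λ (ctBandFn μ K p) (matsubaraFreq β M i)) (trivialMultiplier L M) (trivialMultiplier Lf M)
    (fun _ _ _ => rfl) (fun _ _ _ => rfl) (uvSymbolCT L M β μ K Λ) (uvSymbolCT Lf M β μ K Λ)
    (fun i q σ => uvSymbolCT_eq_sampled hβ μ K Λ (i, q) σ) (fun i q σ => uvSymbolCT_eq_sampled hβ μ K Λ (i, q) σ) e he2 X' Y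

end Summit.HubbardSuperconductivity.HubbardSuperconductivity.Theorems.UVCovarianceAt

end
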